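import Literature.Computability.Complexity.FKPointLocationLevel
import Literature.Computability.Complexity.BoolEncodings
import Literature.Computability.Complexity.StackUnaryBits
import Mathlib.Data.Nat.Size
import HarnessLib

/-!
# Fournier–Koiran point location, V: fixed-width codes of forms and apexes; the prefix-search choices

Topic `Literature/Computability/Complexity`, grouping namespace `FKPointLocation`. The NP prefix
searches of one level (`FKPointLocationLevel.lean`: the chain slots and the apex) run over
FIXED-WIDTH bit codes; this file fixes the codes and instantiates the abstract selection function
`choose` of `LevelCtx.chainBuild` by prefix search (`FKPointLocationSearch.prefixSearch`):

* `natBits w n` (the tree`s little-endian code, `StackUnaryBits.lean`, decoded by `bitsToNat`), `chunkInt`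
  (sign bit + magnitude), `decodeForm`/`encodeForm` (a form `a : Fin D → ℤ` as `D` chunks of
  `bB+1` bits, `bB = size B`), `decodeApex`/`encodeApex` (denominator then `D` numerators, `W` bits
  each), with the round trips `decodeForm_encodeForm`, `decodeApex_encodeApex`;
* `chooseForm` — the form selected by prefix search over form codes with the predicate "decodes to
  the form of a valid triple", and `soundChoose_chooseForm : SoundChoose (chooseForm Λ)`;
* `ApexPredCh` (the apex predicate for an explicit chain; `ApexPred choose sc = ApexPredCh sc (chainOf
  choose sc)`), `chooseApex`, and `apexPredCh_chooseApex` (prefix search finds an apex when one exists).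

## References

* H. Fournier, P. Koiran, *Lower bounds are not easier over the reals: inside PH*, ICALP 2000,
  LNCS 1853 = LIP RR-1999-21, §2.1 (prefix search with an NP oracle for `E_1`, `h`, `s_n^1`), §2.2
  (all coefficients have polynomial size, so the searches have polynomially many rounds).
  [FournierKoiran2000]
-/

namespace Literature.Computability.Complexity

namespace FKPointLocation

open Finset

/-! ### Fixed-width little-endian codes of naturals and integers -/

/-- An integer chunk: sign bit then magnitude. [folklore] -/
def chunkInt (c : List Bool) : ℤ :=
  if c.headD false then -(bitsToNat c.tail : ℤ) else (bitsToNat c.tail : ℤ)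

/-- The code of an integer as a chunk of `b+1` bits. [folklore] -/
def intChunk (b : ℕ) (z : ℤ) : List Bool := decide (z < 0) :: natBits b z.natAbs

/-- Length of an integer chunk. [folklore] -/
@[simp] theorem length_intChunk (b : ℕ) (z : ℤ) : (intChunk b z).length = b + 1 := by
  simp [intChunk]

/-- Round trip for integer chunks (`|z| < 2^b`). [folklore] -/
theorem chunkInt_intChunk {b : ℕ} {z : ℤ} (hz : z.natAbs < 2 ^ b) : chunkInt (intChunk b z) = z := by
  simp only [chunkInt, intChunk, List.headD_cons, List.tail_cons, bitsToNat_natBits hz]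
  by_cases h : z < 0
  · simp only [h, decide_true, if_true]; omega
  · simp only [h, decide_false, Bool.false_eq_true, if_false]; omega

/-- Any chunk decodes to an integer of absolute value `< 2^{|c|-1}` (so `< 2^b` for chunks of
length `b+1`). [folklore] -/
theorem natAbs_chunkInt_lt (c : List Bool) (hc : c ≠ []) : (chunkInt c).natAbs < 2 ^ (c.length - 1) := by
  obtain ⟨b, t, rfl⟩ := List.exists_cons_of_ne_nil hc
  have := bitsToNat_lt t
  simp only [chunkInt, List.headD_cons, List.tail_cons, List.length_cons, Nat.add_sub_cancel]
  split_ifs <;> simpa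

/-! ### Extracting chunks from a concatenation -/

/-- The `i`-th block of length `c` of a concatenation of blocks of length `c`. [folklore] -/
theorem take_drop_flatten {α : Type} {c : ℕ} : ∀ (L : List (List α)) (_ : ∀ l ∈ L, l.length = c)
    (i : ℕ) (_ : i < L.length), (L.flatten.drop (i * c)).take c = L[i]!
  | [], _, i, hi => by simp at hi
  | l :: L, hL, 0, _ => by
    have hl : l.length = c := hL l (by simp)
    simp [← hl, List.take_left']
  | l :: L, hL, i + 1, hi => by
    have hl : l.length = c := hL l (by simp)
    rw [List.flatten_cons, Nat.succ_mul, Nat.add_comm, ← hl, ← List.drop_drop, List.drop_left, hl]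
    have := take_drop_flatten L (fun l' h => hL l' (by simp [h])) i (by simpa using hi)
    simpa using this

/-! ### Codes of forms -/

variable {D : ℕ}

/-- Decoding a form code: `D` chunks of `b+1` bits. [cite: FournierKoiran2000, §2.1 (prefix search for `h`)] -/
def decodeForm (b D : ℕ) (w : List Bool) : Fin D → ℤ :=
  fun i => chunkInt ((w.drop (i.val * (b + 1))).take (b + 1))

/-- The code of a form. [folklore] -/
def encodeForm (b : ℕ) (a : Fin D → ℤ) : List Bool := (List.ofFn fun i => intChunk b (a i)).flatten

/-- Length of a form code. [folklore] -/
theorem length_encodeForm (b : ℕ) (a : Fin D → ℤ) : (encodeForm b a).length = D * (b + 1) := by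
  simp [encodeForm, List.length_flatten, Function.comp_def]

/-- Round trip for form codes (`|a_i| < 2^b`). [folklore] -/
theorem decodeForm_encodeForm {b : ℕ} {a : Fin D → ℤ} (ha : ∀ i, (a i).natAbs < 2 ^ b) :
    decodeForm b D (encodeForm b a) = a := by
  funext i
  rw [decodeForm, encodeForm, take_drop_flatten _ (fun l hl => ?_) i.val (by simp)]
  · simp [chunkInt_intChunk (ha i)]
  · rw [List.mem_ofFn] at hl
    obtain ⟨j, rfl⟩ := hl
    simp

/-- Decoded forms are bounded by `2^b` in absolute value. [folklore] -/
theorem natAbs_decodeForm_lt (b D : ℕ) (w : List Bool) (hw : D * (b + 1) ≤ w.length) (i : Fin D) :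
    (decodeForm b D w i).natAbs < 2 ^ b := by
  rw [decodeForm]
  have hlen : ((w.drop (i.val * (b + 1))).take (b + 1)).length = b + 1 := by
    rw [List.length_take, List.length_drop]
    have : (i.val + 1) * (b + 1) ≤ D * (b + 1) := Nat.mul_le_mul_right _ i.isLt
    rw [Nat.succ_mul] at this
    omega
  have := natAbs_chunkInt_lt ((w.drop (i.val * (b + 1))).take (b + 1))
    (List.ne_nil_of_length_eq_add_one hlen)
  rwa [hlen, Nat.add_sub_cancel] at this

/-! ### Codes of apexes -/

/-- Decoding an apex code: denominator (`W` bits) then `D` numerator chunks (`W+1` bits each).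
[cite: FournierKoiran2000, §2.1 ("compute a point `s_n^1`"), here by prefix search] -/
def decodeApex (W D : ℕ) (w : List Bool) : (Fin D → ℤ) × ℕ :=
  (fun i => chunkInt (((w.drop W).drop (i.val * (W + 1))).take (W + 1)), bitsToNat (w.take W))

/-- The code of an apex. [folklore] -/
def encodeApex (W : ℕ) (N : Fin D → ℤ) (d : ℕ) : List Bool := natBits W d ++ encodeForm W N

/-- Length of an apex code. [folklore] -/
theorem length_encodeApex (W : ℕ) (N : Fin D → ℤ) (d : ℕ) :
    (encodeApex W N d).length = W + D * (W + 1) := by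
  simp [encodeApex, length_encodeForm]

/-- Round trip for apex codes (`d < 2^W`, `|N_i| < 2^W`). [folklore] -/
theorem decodeApex_encodeApex {W : ℕ} {N : Fin D → ℤ} {d : ℕ} (hd : d < 2 ^ W) (hN : ∀ i, (N i).natAbs < 2 ^ W) :
    decodeApex W D (encodeApex W N d) = (N, d) := by
  have h1 : (encodeApex W N d).take W = natBits W d := by
    rw [encodeApex, List.take_left' (length_natBits W d)]
  have h2 : (encodeApex W N d).drop W = encodeForm W N := by
    rw [encodeApex, List.drop_left' (length_natBits W d)]
  have h3 := decodeForm_encodeForm hN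
  simp only [decodeApex, h1, h2, bitsToNat_natBits hd, Prod.mk.injEq, and_true]
  funext i
  exact congrFun h3 i

/-! ### The choices of one level by prefix search -/

namespace LevelCtx

variable {Q : LevelParams} (Λ : LevelCtx Q)

/-- Bits per coefficient: `B < 2^{bB}`. [folklore] -/
def _root_.Literature.Computability.Complexity.FKPointLocation.LevelParams.bB (Q : LevelParams) : ℕ := Nat.size Q.B

/-- Width of form codes. [folklore] -/
def _root_.Literature.Computability.Complexity.FKPointLocation.LevelParams.Wf (Q : LevelParams) : ℕ := Q.D * (Q.bB + 1)

/-- Width of apex codes. [folklore] -/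
def _root_.Literature.Computability.Complexity.FKPointLocation.LevelParams.Wa (Q : LevelParams) : ℕ := Q.W + Q.D * (Q.W + 1)

/-- The prefix-search predicate of a chain slot: "the word has full width and decodes to the form
of a valid triple". [cite: FournierKoiran2000, §2.1 ("such an `h` can be determined by prefix search")] -/
def FormP (sc : ℕ) (ch : List (Fin Q.D → ℤ)) (w : List Bool) : Prop :=
  w.length = Q.Wf ∧ ∃ z z', Λ.ValidTriple sc ch (decodeForm Q.bB Q.D w) z z'

/-- **The form chosen by prefix search** for the chain `ch` at scale `sc`. [cite: FournierKoiran2000, §2.1] -/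
noncomputable def chooseForm (sc : ℕ) (ch : List (Fin Q.D → ℤ)) : Fin Q.D → ℤ :=
  decodeForm Q.bB Q.D (prefixSearch (Λ.FormP sc ch) Q.Wf Q.Wf [])

/-- **Prefix search over form codes is a sound selection** (`LevelCtx.SoundChoose`): whenever some
valid triple exists, the chosen form is the form of one. [cite: FournierKoiran2000, §2.1] -/
theorem soundChoose_chooseForm : Λ.SoundChoose Λ.chooseForm := by
  intro sc ch ⟨a, z, z', hv⟩
  have haB : ∀ i, (a i).natAbs < 2 ^ Q.bB := fun i =>
    lt_of_le_of_lt ((Λ.mem_F.1 hv.1).1.1 i) (Nat.lt_size_self Q.B)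
  have hP : Λ.FormP sc ch (encodeForm Q.bB a) :=
    ⟨length_encodeForm _ _, z, z', by rw [decodeForm_encodeForm haB]; exact hv⟩
  have hspec := prefixSearch_spec (Λ.FormP sc ch) Q.Wf Q.Wf []
    ⟨encodeForm Q.bB a, hP, length_encodeForm _ _, List.nil_prefix⟩ (by simp)
  exact hspec.1.2

/-- The apex predicate for an EXPLICIT chain `ch` (`ApexPred choose sc` is the case
`ch = chainOf choose sc`). [cite: FournierKoiran2000, §2.1] -/
def ApexPredCh (sc : ℕ) (ch : List (Fin Q.D → ℤ)) (N : Fin Q.D → ℤ) (d : ℕ) : Prop :=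
  0 < d ∧ d < 2 ^ Q.W ∧ (∀ k, (N k).natAbs < 2 ^ Q.W) ∧
    (∀ e ∈ Λ.Esys ch, ∑ k, e.1 k * N k = e.2 * d) ∧
    ∀ i, Λ.χ i = 0 → 4 * (N i * 2 ^ (Q.L + 1) - Λ.m i * d).natAbs ≤ d * 2 ^ (Q.κ * (sc + 1))

/-- `ApexPred` is `ApexPredCh` at the built chain. [folklore] -/
theorem apexPred_iff (choose : ℕ → List (Fin Q.D → ℤ) → (Fin Q.D → ℤ)) (sc : ℕ) (N : Fin Q.D → ℤ) (d : ℕ) :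
    Λ.ApexPred choose sc N d ↔ Λ.ApexPredCh sc (Λ.chainOf choose sc) N d :=
  Iff.rfl

/-- The prefix-search predicate of the apex search. [cite: FournierKoiran2000, §2.1] -/
def ApexP (sc : ℕ) (ch : List (Fin Q.D → ℤ)) (w : List Bool) : Prop :=
  w.length = Q.Wa ∧ Λ.ApexPredCh sc ch (decodeApex Q.W Q.D w).1 (decodeApex Q.W Q.D w).2

/-- **The apex chosen by prefix search.** [cite: FournierKoiran2000, §2.1 ("we can easily compute a point `s_n^1`")] -/
noncomputable def chooseApex (sc : ℕ) (ch : List (Fin Q.D → ℤ)) : (Fin Q.D → ℤ) × ℕ :=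
  decodeApex Q.W Q.D (prefixSearch (Λ.ApexP sc ch) Q.Wa Q.Wa [])

/-- **Prefix search over apex codes finds an apex whenever one exists.** [cite: FournierKoiran2000, §2.1] -/
theorem apexPredCh_chooseApex {sc : ℕ} {ch : List (Fin Q.D → ℤ)} (h : ∃ N d, Λ.ApexPredCh sc ch N d) :
    Λ.ApexPredCh sc ch (Λ.chooseApex sc ch).1 (Λ.chooseApex sc ch).2 := by
  obtain ⟨N, d, hA⟩ := h
  have hrt : decodeApex Q.W Q.D (encodeApex Q.W N d) = (N, d) := decodeApex_encodeApex hA.2.1 hA.2.2.1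
  have hP : Λ.ApexP sc ch (encodeApex Q.W N d) := by
    refine ⟨length_encodeApex _ _ _, ?_⟩
    rw [hrt]; exact hA
  have hspec := prefixSearch_spec (Λ.ApexP sc ch) Q.Wa Q.Wa []
    ⟨encodeApex Q.W N d, hP, length_encodeApex _ _ _, List.nil_prefix⟩ (by simp)
  exact hspec.1.2

end LevelCtx

end FKPointLocation

end Literature.Computability.Complexity
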